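import Mathlib
import Summits.Ventures.PercRepro.TriangleCapBipartiteStarDefs

/-!
# PercRepro — THE BIPARTITE SUB-PROBLEM WITH FIXED PARTS IS EXACT: `K_{a,n−a}` minus a star of `r` edges
(p3, gen 34; part 36b)

For bipartite spanning graphs with parts `X` (`|X| = a`) and `Xᶜ` and `m = a(n−a) − r` edges,
TriangleCapBipartiteDeficit gives `Σ_v d(v)² + r(n − r − 1) ≤ m·n` (the missing cross pairs number exactly `r`,
`card_missing_add_card_edges`).  The bound is attained by `K_{a,n−a}` minus `r` edges at one left vertex
(`bipMinusStar n a r`, TriangleCapBipartiteStarDefs): `Σ_v d(v)² + r(2n − r − 1) = a(n−a)·n`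
(`sums_bipMinusStar`), `a(n−a) − r` edges, `2·cherries + r(2n − r − 3) = a(n−a)(n − 2)`.  Hence

* **`bipartite_fixed_parts_exact`** — for `1 ≤ a` and `a + r ≤ n`, the maximum of `2·Σ_v C(d(v), 2)` over the
  bipartite graphs on `Fin n` with left part `{i : i < a}` and `a(n−a) − r` edges is `a(n−a)(n−2) − r(2n − r − 3)`
  — the envelope value `m(n − 2)` minus `r(n − r − 1)`: the `r`-term of the closed form of
  P3-TRIANGLE-CAP.md §10av for the parts `(a, n−a)`.

Axioms: standard.
-/

namespace PercRepro

namespace TriangleCap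

namespace C047

open Finset

variable {V : Type*} [Fintype V] [DecidableEq V]
/-- A sum over `Fin n` split at `0`, the star vertices, and the rest. -/
theorem sum_bipMinusStar_split (n a r : ℕ) (ha : 1 ≤ a) (har : a + r ≤ n) (f : Fin n → ℕ) :
    ∑ v, f v = f ⟨0, by omega⟩ + ∑ v ∈ rightStar n a r, f v +
      ∑ v ∈ (univ.erase ⟨0, by omega⟩) \ rightStar n a r, f v := by
  have h0 : (⟨0, by omega⟩ : Fin n) ∉ rightStar n a r := by
    simp only [rightStar, mem_filter, mem_univ, true_and]
    omega
  have hsub : rightStar n a r ⊆ univ.erase ⟨0, by omega⟩ := by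
    intro v hv
    rw [mem_erase]
    exact ⟨fun h => h0 (h ▸ hv), mem_univ _⟩
  have h1 := add_sum_erase (univ : Finset (Fin n)) f (mem_univ ⟨0, by omega⟩)
  have h2 := sum_sdiff hsub (f := f)
  omega

/-- On `bipMinusStar n a r`: `Σ_v d(v) + 2r = 2a(n−a)` and `Σ_v d(v)² + r(2n − r − 1) = a(n−a)·n`. -/
theorem sums_bipMinusStar (n a r : ℕ) (ha : 1 ≤ a) (har : a + r ≤ n) :
    ∑ v, deg (bipMinusStar n a r) v + 2 * r = 2 * (a * (n - a)) ∧
      ∑ v, deg (bipMinusStar n a r) v * deg (bipMinusStar n a r) v + r * (2 * n - r - 1) =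
        a * (n - a) * n := by
  have hd := deg_bipMinusStar n a r ha har
  have hn : 0 < n := by omega
  have h0 : deg (bipMinusStar n a r) ⟨0, hn⟩ = n - a - r := by rw [hd]; simp
  have hS : ∀ v ∈ rightStar n a r, deg (bipMinusStar n a r) v = a - 1 := by
    intro v hv
    have hv' := hv
    simp only [rightStar, mem_filter, mem_univ, true_and] at hv'
    rw [hd, if_neg (by omega), if_pos hv]
  have hrest : ∀ v ∈ (univ.erase ⟨0, hn⟩) \ rightStar n a r,
      deg (bipMinusStar n a r) v = deg (bip n a) v := by
    intro v hv
    rw [mem_sdiff, mem_erase] at hv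
    rw [hd, if_neg, if_neg hv.2]
    intro h; exact hv.1.1 (Fin.ext h)
  have hb0 : deg (bip n a) ⟨0, hn⟩ = n - a := deg_bip_of_lt n a (by omega) _ (by simp; omega)
  have hbS : ∀ v ∈ rightStar n a r, deg (bip n a) v = a := by
    intro v hv
    simp only [rightStar, mem_filter, mem_univ, true_and] at hv
    exact deg_bip_of_not_lt n a (by omega) v (by omega)
  have hcard := card_rightStar n a r har
  -- arithmetic: substitute `n = a + r + b`, `a = c + 1`
  obtain ⟨b, hb⟩ : ∃ b, n = a + r + b := ⟨n - a - r, by omega⟩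
  obtain ⟨c, hc⟩ : ∃ c, a = c + 1 := ⟨a - 1, by omega⟩
  subst hb
  subst hc
  -- the degree values without subtraction
  have h0' : deg (bipMinusStar (c + 1 + r + b) (c + 1) r) ⟨0, hn⟩ = b := by rw [h0]; omega
  have hS' : ∀ v ∈ rightStar (c + 1 + r + b) (c + 1) r, deg (bipMinusStar (c + 1 + r + b) (c + 1) r) v = c := by
    intro v hv; rw [hS v hv]; omega
  have hb0' : deg (bip (c + 1 + r + b) (c + 1)) ⟨0, hn⟩ = r + b := by rw [hb0]; omega
  have hS2' : ∀ v ∈ rightStar (c + 1 + r + b) (c + 1) r,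
      deg (bipMinusStar (c + 1 + r + b) (c + 1) r) v * deg (bipMinusStar (c + 1 + r + b) (c + 1) r) v =
        c * c := by
    intro v hv; rw [hS' v hv]
  have hbS2 : ∀ v ∈ rightStar (c + 1 + r + b) (c + 1) r,
      deg (bip (c + 1 + r + b) (c + 1)) v * deg (bip (c + 1 + r + b) (c + 1)) v = (c + 1) * (c + 1) := by
    intro v hv; rw [hbS v hv]
  have hrest2 : ∀ v ∈ (univ.erase ⟨0, hn⟩) \ rightStar (c + 1 + r + b) (c + 1) r,
      deg (bipMinusStar (c + 1 + r + b) (c + 1) r) v * deg (bipMinusStar (c + 1 + r + b) (c + 1) r) v =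
        deg (bip (c + 1 + r + b) (c + 1)) v * deg (bip (c + 1 + r + b) (c + 1)) v := by
    intro v hv; rw [hrest v hv]
  -- the four split sums (explicit, beta-reduced statements)
  have s1 : ∑ v, deg (bipMinusStar (c + 1 + r + b) (c + 1) r) v = deg (bipMinusStar (c + 1 + r + b) (c + 1) r) ⟨0, hn⟩ +
      ∑ v ∈ rightStar (c + 1 + r + b) (c + 1) r, deg (bipMinusStar (c + 1 + r + b) (c + 1) r) v +
      ∑ v ∈ (univ.erase ⟨0, hn⟩) \ rightStar (c + 1 + r + b) (c + 1) r, deg (bipMinusStar (c + 1 + r + b) (c + 1) r) v :=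
    sum_bipMinusStar_split (c + 1 + r + b) (c + 1) r ha har _
  have s1' : ∑ v, deg (bip (c + 1 + r + b) (c + 1)) v = deg (bip (c + 1 + r + b) (c + 1)) ⟨0, hn⟩ +
      ∑ v ∈ rightStar (c + 1 + r + b) (c + 1) r, deg (bip (c + 1 + r + b) (c + 1)) v +
      ∑ v ∈ (univ.erase ⟨0, hn⟩) \ rightStar (c + 1 + r + b) (c + 1) r, deg (bip (c + 1 + r + b) (c + 1)) v :=
    sum_bipMinusStar_split (c + 1 + r + b) (c + 1) r ha har _
  have s2 : ∑ v, deg (bipMinusStar (c + 1 + r + b) (c + 1) r) v * deg (bipMinusStar (c + 1 + r + b) (c + 1) r) v =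
      deg (bipMinusStar (c + 1 + r + b) (c + 1) r) ⟨0, hn⟩ * deg (bipMinusStar (c + 1 + r + b) (c + 1) r) ⟨0, hn⟩ +
      ∑ v ∈ rightStar (c + 1 + r + b) (c + 1) r, deg (bipMinusStar (c + 1 + r + b) (c + 1) r) v * deg (bipMinusStar (c + 1 + r + b) (c + 1) r) v +
      ∑ v ∈ (univ.erase ⟨0, hn⟩) \ rightStar (c + 1 + r + b) (c + 1) r,
        deg (bipMinusStar (c + 1 + r + b) (c + 1) r) v * deg (bipMinusStar (c + 1 + r + b) (c + 1) r) v :=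
    sum_bipMinusStar_split (c + 1 + r + b) (c + 1) r ha har _
  have s2' : ∑ v, deg (bip (c + 1 + r + b) (c + 1)) v * deg (bip (c + 1 + r + b) (c + 1)) v =
      deg (bip (c + 1 + r + b) (c + 1)) ⟨0, hn⟩ * deg (bip (c + 1 + r + b) (c + 1)) ⟨0, hn⟩ +
      ∑ v ∈ rightStar (c + 1 + r + b) (c + 1) r, deg (bip (c + 1 + r + b) (c + 1)) v * deg (bip (c + 1 + r + b) (c + 1)) v +
      ∑ v ∈ (univ.erase ⟨0, hn⟩) \ rightStar (c + 1 + r + b) (c + 1) r, deg (bip (c + 1 + r + b) (c + 1)) v * deg (bip (c + 1 + r + b) (c + 1)) v :=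
    sum_bipMinusStar_split (c + 1 + r + b) (c + 1) r ha har _
  have c1 : ∑ v ∈ rightStar (c + 1 + r + b) (c + 1) r, deg (bipMinusStar (c + 1 + r + b) (c + 1) r) v =
      r * c := by
    rw [sum_congr rfl hS', sum_const, smul_eq_mul, hcard]
  have c1' : ∑ v ∈ rightStar (c + 1 + r + b) (c + 1) r, deg (bip (c + 1 + r + b) (c + 1)) v =
      r * (c + 1) := by
    rw [sum_congr rfl hbS, sum_const, smul_eq_mul, hcard]
  have c2 : ∑ v ∈ rightStar (c + 1 + r + b) (c + 1) r,
      deg (bipMinusStar (c + 1 + r + b) (c + 1) r) v * deg (bipMinusStar (c + 1 + r + b) (c + 1) r) v =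
      r * (c * c) := by
    rw [sum_congr rfl hS2', sum_const, smul_eq_mul, hcard]
  have c2' : ∑ v ∈ rightStar (c + 1 + r + b) (c + 1) r,
      deg (bip (c + 1 + r + b) (c + 1)) v * deg (bip (c + 1 + r + b) (c + 1)) v =
      r * ((c + 1) * (c + 1)) := by
    rw [sum_congr rfl hbS2, sum_const, smul_eq_mul, hcard]
  have cR : ∑ v ∈ (univ.erase ⟨0, hn⟩) \ rightStar (c + 1 + r + b) (c + 1) r,
      deg (bipMinusStar (c + 1 + r + b) (c + 1) r) v =
      ∑ v ∈ (univ.erase ⟨0, hn⟩) \ rightStar (c + 1 + r + b) (c + 1) r, deg (bip (c + 1 + r + b) (c + 1)) v :=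
    sum_congr rfl hrest
  have cR2 : ∑ v ∈ (univ.erase ⟨0, hn⟩) \ rightStar (c + 1 + r + b) (c + 1) r,
      deg (bipMinusStar (c + 1 + r + b) (c + 1) r) v * deg (bipMinusStar (c + 1 + r + b) (c + 1) r) v =
      ∑ v ∈ (univ.erase ⟨0, hn⟩) \ rightStar (c + 1 + r + b) (c + 1) r,
        deg (bip (c + 1 + r + b) (c + 1)) v * deg (bip (c + 1 + r + b) (c + 1)) v :=
    sum_congr rfl hrest2
  rw [h0', c1, cR] at s1
  rw [hb0', c1'] at s1'
  rw [h0', c2, cR2] at s2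
  rw [hb0', c2'] at s2'
  have sb := sum_deg_bip (c + 1 + r + b) (c + 1) (by omega)
  have sq := sum_deg_sq_bip (c + 1 + r + b) (c + 1) (by omega)
  -- clean the subtractions in `sb`, `sq` and the goal
  have e2 : c + 1 + r + b - (c + 1) = r + b := by omega
  rw [e2] at sb sq
  have g1 : (c + 1) * (c + 1 + r + b - (c + 1)) = (c + 1) * (r + b) := by rw [e2]
  have g2 : r * (2 * (c + 1 + r + b) - r - 1) = r * (2 * c + r + 2 * b + 1) := by
    congr 1; omega
  rw [g1, g2]
  -- expansions
  have x0 : r * (c + 1) = r * c + r := by ring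
  have x1 : (r + b) * (r + b) = r * r + 2 * (r * b) + b * b := by ring
  have x2 : r * ((c + 1) * (c + 1)) = r * (c * c) + 2 * (r * c) + r := by ring
  have x3 : r * (2 * c + r + 2 * b + 1) = 2 * (r * c) + r * r + 2 * (r * b) + r := by ring
  have x4 : 2 * ((c + 1) * (r + b)) = 2 * (r * c) + 2 * (c * b) + 2 * r + 2 * b := by ring
  have x5 : (c + 1) * (r + b) * (c + 1 + r + b) =
      c * c * r + c * c * b + 2 * (r * c) + 2 * (c * b) + c * (r * r) + 2 * (c * (r * b)) + c * (b * b) +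
        r * r + 2 * (r * b) + b * b + r + b := by ring
  rw [x0] at s1'
  rw [x1, x2] at s2'
  rw [x3]
  rw [x4] at sb
  rw [x5] at sq
  have x6 : c * (r * r) = r * (c * r) := by ring
  have x7 : r * (c * c) = c * (c * r) := by ring
  have x8 : c * c * r = c * (c * r) := by ring
  constructor
  · omega
  · omega

/-- `bipMinusStar n a r` has `a(n−a) − r` edges. -/
theorem card_edges_bipMinusStar (n a r : ℕ) (ha : 1 ≤ a) (har : a + r ≤ n) :
    (bipMinusStar n a r).edgeFinset.card + r = a * (n - a) := by
  have h := (sums_bipMinusStar n a r ha har).1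
  rw [sum_deg_eq] at h
  omega

/-- `2·cherries(bipMinusStar n a r) + r(2n − r − 3) = a(n−a)(n − 2)`: the witness attains the bipartite bound. -/
theorem two_mul_cherries_bipMinusStar (n a r : ℕ) (ha : 1 ≤ a) (har : a + r ≤ n) (hn : 2 ≤ n) :
    2 * cherries (bipMinusStar n a r) + r * (2 * n - r - 3) = a * (n - a) * (n - 2) := by
  have h1 := two_mul_cherries_add (bipMinusStar n a r)
  have ⟨h2, h3⟩ := sums_bipMinusStar n a r ha har
  obtain ⟨F, hF⟩ : ∃ F, a * (n - a) = F := ⟨_, rfl⟩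
  rw [hF] at h2 h3 ⊢
  obtain ⟨j, hj⟩ := Nat.exists_eq_add_of_le hn
  have hr : r ≤ j + 1 := by omega
  obtain ⟨t, ht⟩ : ∃ t, j + 1 = r + t := ⟨j + 1 - r, by omega⟩
  have e1 : n - 2 = j := by omega
  have e2 : 2 * n - r - 1 = t + j + 2 := by omega
  have e3 : 2 * n - r - 3 = t + j := by omega
  rw [e1, e3]
  rw [e2] at h3
  have p1 : F * n = F * j + 2 * F := by rw [hj]; ring
  rw [p1] at h3
  have p2 : r * (t + j + 2) = r * t + r * j + 2 * r := by ring
  rw [p2] at h3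
  have p3 : r * (t + j) = r * t + r * j := by ring
  rw [p3]
  omega

/-- **THE BIPARTITE SUB-PROBLEM WITH FIXED PARTS IS EXACT:** for `1 ≤ a` and `a + r ≤ n`, the maximum of
`2·Σ_v C(d(v), 2)` over bipartite graphs on `Fin n` with left part `{i : i < a}` and `a(n−a) − r` edges is
`a(n−a)(n−2) − r(2n − r − 3)`. -/
theorem bipartite_fixed_parts_exact (n a r : ℕ) (ha : 1 ≤ a) (har : a + r ≤ n) (hn : 2 ≤ n) :
    (∀ (D : SimpleGraph (Fin n)) [DecidableRel D.Adj],
        (∀ x y, D.Adj x y → (x ∈ univ.filter (fun i : Fin n => i.val < a) ↔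
          y ∉ univ.filter (fun i : Fin n => i.val < a))) →
        D.edgeFinset.card + r = a * (n - a) →
        2 * cherries D + r * (2 * n - r - 3) ≤ a * (n - a) * (n - 2)) ∧
      ∃ (D : SimpleGraph (Fin n)) (_ : DecidableRel D.Adj),
        (∀ x y, D.Adj x y → (x ∈ univ.filter (fun i : Fin n => i.val < a) ↔
          y ∉ univ.filter (fun i : Fin n => i.val < a))) ∧
        D.edgeFinset.card + r = a * (n - a) ∧
        2 * cherries D + r * (2 * n - r - 3) = a * (n - a) * (n - 2) := by
  refine ⟨fun D _ hbip hD => ?_, bipMinusStar n a r, inferInstance, bipMinusStar_bipartite n a r,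
    card_edges_bipMinusStar n a r ha har, two_mul_cherries_bipMinusStar n a r ha har hn⟩
  have h := sum_deg_sq_le_of_bipartite D _ hbip
  have hN := card_missing_add_card_edges D _ hbip
  rw [card_left n a (by omega), card_compl, Fintype.card_fin, card_left n a (by omega)] at hN
  have hr : (missing D (univ.filter (fun i : Fin n => i.val < a))
      (univ.filter (fun i : Fin n => i.val < a))ᶜ).card = r := by omega
  rw [hr, Fintype.card_fin] at h
  have h2 := two_mul_cherries_add D
  rw [sum_deg_eq] at h2
  -- `m = a(n−a) − r`; substitute `n = 2 + j`
  obtain ⟨j, hj⟩ := Nat.exists_eq_add_of_le hn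
  have hr' : r ≤ j + 1 := by omega
  obtain ⟨t, ht⟩ : ∃ t, j + 1 = r + t := ⟨j + 1 - r, by omega⟩
  have e1 : n - 2 = j := by omega
  have e2 : n - r - 1 = t := by omega
  have e3 : 2 * n - r - 3 = t + j := by omega
  rw [e1, e3]
  rw [e2] at h
  obtain ⟨m, hm⟩ : ∃ m, D.edgeFinset.card = m := ⟨_, rfl⟩
  rw [hm] at h h2 hD
  have p1 : m * n = m * j + 2 * m := by rw [hj]; ring
  rw [p1] at h
  have p2 : a * (n - a) * j = m * j + r * j := by rw [← hD]; ring
  rw [p2]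
  have p3 : r * (t + j) = r * t + r * j := by ring
  rw [p3]
  omega

end C047

end TriangleCap

end PercRepro
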